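import Literature.NumberTheory.EllipticCurves.IsogenyPeriodLatticeProofs
import HarnessLib

/-!
# An isogeny of degree one between elliptic curves over a number field is a change of variables

A *proofs* file (theorems only; no definition, no named fact, no instance) on top of the prelude
`Literature.NumberTheory.EllipticCurves.Isogeny` (an isogeny over `K` = a `Γ_K`-equivariant,
algebraic homomorphism of `K̄`-points with finite kernel; `Isogeny.degree = #ker`) and the tree's
analytic description of isogenies over number fields
(`WeierstrassCurve.Isogeny.exists_multiplier_of_isShort`, `IsogenyPeriodLatticeProofs`:
the multiplier `α₀ ∈ Kˣ` with `σ(α₀)Λ ⊆ Λ'` of index `deg` at every complex place).  It proves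

* `WeierstrassCurve.Isogeny.exists_variableChange_eq_of_degree_eq_one` — **for elliptic curves
  `W, W'` over a number field `K` and an isogeny `φ : W → W'` over `K` of degree `1` there is an
  admissible change of variables `C` over `K` with `C • W = W'`** (Silverman, *AEC*, II.2.4.1: a map
  of degree one between smooth curves is an isomorphism; III.3.1(b): two Weierstrass equations of
  the same elliptic curve over `K` are related by a change of variables `(u, r, s, t)` over `K`).

Proof.  Pass to short models `E = C_W • W`, `E' = C_{W'} • W'` (`shortChange_a₁_a₂_a₃`, `u = 1`)
and to an isogeny `ψ : E → E'` of the same degree (`exists_degree_eq_of_smul`).  By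
`exists_multiplier_of_isShort` there is `α₀ ∈ Kˣ` such that at a complex place `σ` and Néron-type
period pairs `Λ, Λ'` of `E^σ, E'^σ` (`exists_periodPair_of_isElliptic'`): `σ(α₀)Λ ⊆ Λ'` with index
`deg ψ = 1`, i.e. `σ(α₀)Λ = Λ'`.  Hence `g₂(Λ') = σ(α₀)⁻⁴ g₂(Λ)`, `g₃(Λ') = σ(α₀)⁻⁶ g₃(Λ)`
(`PeriodPair.g₂_mulLeft`, `g₃_mulLeft`), i.e. `c₄(E') = α₀⁻⁴ c₄(E)`, `c₆(E') = α₀⁻⁶ c₆(E)` in `K`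
(`σ` is injective); for short models `a₄ = -c₄/48`, `a₆ = -c₆/864`, so `E' = ⟨α₀, 0, 0, 0⟩ • E`, and
`W' = (C_{W'}⁻¹ · ⟨α₀, 0, 0, 0⟩ · C_W) • W`.

## References

* [SilvermanAEC2009] J. H. Silverman, *The Arithmetic of Elliptic Curves*, 2nd ed., GTM 106 (2009),
  II.2.4.1, III.1 (Table 3.1), III.3.1(b), Thm. VI.4.1(b), Cor. VI.5.1.1.

## Design

`noncomputable section`, `open scoped Classical`, deliberate dot-notation extensions in
`namespace WeierstrassCurve.Isogeny` as in the sibling isogeny proofs files.  Stated over a number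
field (the generality of `exists_multiplier_of_isShort`); the `ℚ` case is the one consumed by the
`2`-power isogeny walk of the BSD door route `EisensteinDepletionAtTwo` (crux `StarOptBNSF`).
-/

noncomputable section

open scoped Classical

universe u

namespace WeierstrassCurve

namespace Isogeny

open Literature.NumberTheory.EllipticCurves PeriodPair

variable {K : Type u} [Field K] [NumberField K] {W W' : WeierstrassCurve K}

/-- For a short Weierstrass model (`a₁ = a₂ = a₃ = 0`): `a₄ = -c₄ / 48`. Silverman, *AEC*, III.1.
[cite: SilvermanAEC2009, III.1 Table 3.1] -/
theorem a₄_eq_of_isShort {F : Type u} [Field F] [CharZero F] (E : WeierstrassCurve F) (h₁ : E.a₁ = 0)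
    (h₂ : E.a₂ = 0) (h₃ : E.a₃ = 0) : E.a₄ = -E.c₄ / 48 := by
  simp only [WeierstrassCurve.c₄, WeierstrassCurve.b₂, WeierstrassCurve.b₄, h₁, h₂, h₃]
  ring

/-- For a short Weierstrass model (`a₁ = a₂ = a₃ = 0`): `a₆ = -c₆ / 864`. Silverman, *AEC*, III.1.
[cite: SilvermanAEC2009, III.1 Table 3.1] -/
theorem a₆_eq_of_isShort {F : Type u} [Field F] [CharZero F] (E : WeierstrassCurve F) (h₁ : E.a₁ = 0)
    (h₂ : E.a₂ = 0) (h₃ : E.a₃ = 0) : E.a₆ = -E.c₆ / 864 := by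
  simp only [WeierstrassCurve.c₆, WeierstrassCurve.b₂, WeierstrassCurve.b₄, WeierstrassCurve.b₆, h₁, h₂, h₃]
  ring

/-- **Degree-one isogenies of short models are rescalings.**  For short Weierstrass models `E, E'`
(`a₁ = a₂ = a₃ = 0`) of elliptic curves over a number field `K` and an isogeny `ψ : E → E'` over `K`
with `#ker ψ = 1`, there is `α₀ ∈ Kˣ` with `E' = ⟨α₀, 0, 0, 0⟩ • E` (at a complex place the multiplier
`α₀` of `exists_multiplier_of_isShort` satisfies `σ(α₀)Λ = Λ'`, whence `c₄' = α₀⁻⁴c₄`, `c₆' = α₀⁻⁶c₆`).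
Silverman, *AEC*, Thm. VI.4.1(b), Cor. VI.5.1.1, III.1 Table 3.1.
[cite: SilvermanAEC2009, Thm. VI.4.1(b) and Cor. VI.5.1.1] -/
theorem exists_variableChange_eq_of_degree_eq_one_of_isShort [W.IsElliptic] [W'.IsElliptic]
    (ψ : Isogeny W W') (hdeg : ψ.degree = 1) (h₁ : W.a₁ = 0) (h₂ : W.a₂ = 0) (h₃ : W.a₃ = 0)
    (h₁' : W'.a₁ = 0) (h₂' : W'.a₂ = 0) (h₃' : W'.a₃ = 0) :
    ∃ (α₀ : K) (hα₀ : α₀ ≠ 0), (⟨Units.mk0 α₀ hα₀, 0, 0, 0⟩ : VariableChange K) • W = W' := by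
  obtain ⟨α₀, hα₀, -, han⟩ := exists_multiplier_of_isShort ψ h₁ h₂ h₃ h₁' h₂' h₃'
  refine ⟨α₀, hα₀, ?_⟩
  -- a complex place of `K`
  obtain ⟨σ⟩ : Nonempty (K →+* ℂ) := inferInstance
  obtain ⟨L, hL₂, hL₃⟩ := (W.map σ).exists_periodPair_of_isElliptic'
  obtain ⟨L', hL₂', hL₃'⟩ := (W'.map σ).exists_periodPair_of_isElliptic'
  obtain ⟨hσ, hle, hind⟩ := han σ L L' hL₂ hL₃ hL₂' hL₃'
  rw [hdeg] at hind
  -- `σ(α₀)Λ = Λ'`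
  have hLL : (L.mulLeft (σ α₀) hσ).lattice = L'.lattice :=
    le_antisymm hle fun x hx ↦ AddSubgroup.relIndex_eq_one.mp hind hx
  -- `c₄' = α₀⁻⁴ c₄`, `c₆' = α₀⁻⁶ c₆`
  have hc₄ : W'.c₄ = (α₀ ^ 4)⁻¹ * W.c₄ := by
    have h := PeriodPair.g₂_eq_of_lattice_eq hLL
    rw [PeriodPair.g₂_mulLeft, hL₂, hL₂', map_c₄, map_c₄] at h
    apply σ.injective
    rw [map_mul, map_inv₀, map_pow]
    linear_combination 12 * h.symm
  have hc₆ : W'.c₆ = (α₀ ^ 6)⁻¹ * W.c₆ := by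
    have h := PeriodPair.g₃_eq_of_lattice_eq hLL
    rw [PeriodPair.g₃_mulLeft, hL₃, hL₃', map_c₆, map_c₆] at h
    apply σ.injective
    rw [map_mul, map_inv₀, map_pow]
    linear_combination 216 * h.symm
  have ha₄ := a₄_eq_of_isShort W h₁ h₂ h₃
  have ha₆ := a₆_eq_of_isShort W h₁ h₂ h₃
  have ha₄' := a₄_eq_of_isShort W' h₁' h₂' h₃'
  have ha₆' := a₆_eq_of_isShort W' h₁' h₂' h₃'
  have hu : ((Units.mk0 α₀ hα₀)⁻¹ : Kˣ) = (α₀⁻¹ : K) := by simp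
  ext
  · simp [variableChange_a₁, h₁, h₁']
  · simp [variableChange_a₂, h₁, h₂, h₂']
  · simp [variableChange_a₃, h₁, h₃, h₃']
  · simp only [variableChange_a₄, h₁, h₂, h₃, hu, mul_zero, sub_zero, add_zero]
    rw [ha₄', hc₄, ha₄, inv_pow]
    ring
  · simp only [variableChange_a₆, h₁, h₂, h₃, hu, mul_zero, sub_zero, add_zero, zero_mul]
    rw [ha₆', hc₆, ha₆, inv_pow]
    ring

/-- **An isogeny of degree one between elliptic curves over a number field is a change of
variables over that field.**  For elliptic curves `W, W'` over a number field `K` and an isogeny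
`φ : W → W'` defined over `K` with `#ker φ = 1` (`Isogeny.degree`, the degree in characteristic `0`)
there is an admissible change of variables `C = (u, r, s, t)` over `K` with `C • W = W'`.
Silverman, *AEC*, II.2.4.1 (degree-one maps of smooth curves are isomorphisms) and III.3.1(b)
(isomorphic Weierstrass models differ by a change of variables over `K`); proved here analytically
(Thm. VI.4.1(b): at a complex place `φ` is `z ↦ αz` with `αΛ = Λ'`, after passage to short models).
[cite: SilvermanAEC2009, II.2.4.1 and Prop. III.3.1(b)] -/
theorem exists_variableChange_eq_of_degree_eq_one [W.IsElliptic] [W'.IsElliptic] (φ : Isogeny W W')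
    (hdeg : φ.degree = 1) : ∃ C : VariableChange K, C • W = W' := by
  haveI : Invertible (2 : K) := invertibleOfNonzero two_ne_zero
  haveI : Invertible (3 : K) := invertibleOfNonzero three_ne_zero
  set C : VariableChange K := ⟨1, -W.b₂ / 12, -W.a₁ / 2, W.a₁ * W.b₂ / 24 - W.a₃ / 2⟩ with hC
  set C' : VariableChange K := ⟨1, -W'.b₂ / 12, -W'.a₁ / 2, W'.a₁ * W'.b₂ / 24 - W'.a₃ / 2⟩
    with hC'
  obtain ⟨h₁, h₂, h₃⟩ := shortChange_a₁_a₂_a₃ W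
  obtain ⟨h₁', h₂', h₃'⟩ := shortChange_a₁_a₂_a₃ W'
  obtain ⟨ψ, hψ⟩ := exists_degree_eq_of_smul φ C C'
  obtain ⟨α₀, hα₀, hD⟩ :=
    exists_variableChange_eq_of_degree_eq_one_of_isShort ψ (hψ.trans hdeg) h₁ h₂ h₃ h₁' h₂' h₃'
  refine ⟨C'⁻¹ * ⟨Units.mk0 α₀ hα₀, 0, 0, 0⟩ * C, ?_⟩
  rw [mul_smul, mul_smul, hD, inv_smul_smul]

end Isogeny

end WeierstrassCurve

end
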